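import Summits.QuantumFields.BalabanUV.Beta.GAN24.Lin4LegTower
import Summits.QuantumFields.BalabanUV.Beta.GAN24.WardResidualSUnroll
import Summits.QuantumFields.BalabanUV.Beta.GAN24.TransversalZeroMode

/-!
# `BalabanUV.Beta.GAN24.Lin4LegTowerTwo` — binder row G-an2-4 ∕ (CONV-C), CT-W, located crux (Q-L) («QL-LL», RULING R-gan24p1-g25-1 R10 (iii)):
# «(REP-leg)» part 2 — THE TWO-STEP (k₀ = 2) FORM OF THE RIGHT-DIVERGENCED LEG TOWER AND THE LEFT-LEG MIRROR (G-an2-4 formalisation swarm, leaf prover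
# `b2b-balaban-gan24-formalise-leaf-03`, gen 60; continues `GAN24/Lin4LegTower`; name PROVISIONAL)

NOT IN PRINT; OUR BOOKKEEPING.  HONEST FRAMING (cell contract, verbatim): «discharging `BetaPertH` makes Bałaban's UV stability
UNCONDITIONAL — a real constructive-QFT result; it is NOT the continuum limit and NOT the Clay problem.»  HONEST DEPENDENCY (verbatim):
«continuum YM on T⁴ ⇐ BetaPertH ∧ nine spine estimates (0/9 proved); BetaPertH ⇐ (D1) ∧ (D4) ∧ CAP+tail; G-an2-4 gates asym, D1 and
NE2/3/4.»

WHAT ([folklore] kernel algebra on leaf-01's bounded-table class over part 1's `rdiv ∕ bsum ∕ mreadL ∕ legStep` BY NAME; one plumbing `def` (`ldiv`);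
0 cite, 0 `def … : Prop`, 0 sorry):
* §1 `bdd_bsum` (`#box = N^{d+1}`, leaf-16's `TransversalZeroMode.card_box_succ` BY NAME), `bsum_mul` (nested block sums `bsum (M·L) = bsum L ∘ bsum M`, p2's `sum_box_mul`), `bdd_legStep` (the one-step leg map preserves
  the bounded class, constant displayed), `legStep_add'` (two bounds).
* §2 **THE TWO-STEP FORM** (WARD6 (9.3)'s window k₀ = 2, the case of record of (WIN-k₀)): for two consecutive affine steps `T₁ = lin4 c₀ K₀ N T + F₀`,
  `T₂ = lin4 c₁ K₁ N T₁ + F₁` (both kernels decaying with their (hH)∕(hM♯) laws):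
  `rdiv (T₂ s) = 𝓛₁ (𝓛₀ (𝔹𝔹 Δ)) s + 𝓛₁ (𝔹 (rdiv ∘ F₀)) s + rdiv (F₁ s)` with `Δ = rdiv ∘ T`, `𝓛_i = legStep (−(c_i·c_{H,i})) K_i K_i N`, `𝔹 = bsum N` — the chain
  `𝓛₁ ∘ 𝓛₀` acts on the super-block-summed member `𝔹𝔹Δ = bsum (N·N) Δ`, NO CROSS TERMS.
* §3 THE LEFT-LEG MIRROR: `ldiv F := trK (rdiv (trK F))` (`Σ_α (F (p − e_α) z (inl α) b − F p z (inl α) b)`), `trK_vsym`, and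
  **`ldiv (lin4 c K N T s) = trK (legStep (−(c·c_H′)) K (trK K) N (fun s ↦ bsum N (rdiv (trK (T s)))) s)`** under the transposed laws (hH′) (constant `c_H′`), (hM♯′)
  (gen-58's `legDiv_lin4_left`): the slots still read the ℋ-columns of `K`, the leg reads a row of `trK K`.
* §4 THE COMB ∕ WALL INSTANCES (`K♮ᴱ_j`, `N = Lc`; right: `c_H = (Lc^{d+1})⁻¹`; left: `c_H′ = −(Lc^{d+1})⁻¹` by `BubbleParity`, gen-58's `hH_trK_unitK_comb`).
Asserts NO norm of `𝓛_j`, of `𝓛₁ ∘ 𝓛₀` ((WIN-k₀)) or of any chain, nothing of (LAY-leg)∕(LT-leg)∕(GRON-k₀), NOT (Q-L-k₀) — OPEN; discharges NOTHING of (Q-L) ∕ (Q-R) ∕ (C) ∕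
«T2Shape» ∕ «T2Drift» ∕ (hW, hWall); 0 wall binders; NEVER «G-an2-4 closed» as (CONV-C); NOT D1, NOT `BetaPertH`, NOT continuum, NOT Clay; not in print.
Unit `b2b-balaban-gan24-formalise-leaf-03` (gen 60), 2026-08-22.
-/

noncomputable section
open Finset
open scoped BigOperators
open Literature.MathematicalPhysics.QuantumFieldTheory
open Literature.MathematicalPhysics.QuantumFieldTheory.Balaban1983to89
open Literature.MathematicalPhysics.QuantumFieldTheory.Balaban1983to89.Beta
open B6BondElimination (unitVec)
open ExpKernelCalculus (MKer Site Decays Zl comp)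
open OneStepResolventKernel (Fib wsum)
open OneStepKernelFamily (colH vertexOfK KInvStep)
open SecondOrderResponse (vertex2OfK)
open BalabanStepJetsSucc (mmRead mmRead_inl_inl mmRead_inr_right)
open KernelWard (Bdd)
open AffineAveraging (box toSite)
open Summit.QuantumFields.BalabanUV.Beta.KernelWardRelative (gaugeWt)
open Summit.QuantumFields.BalabanUV.Beta.GAN24.T2RecursionAffine (vsym lin4 lin4_apply)
open Summit.QuantumFields.BalabanUV.Beta.GAN24.Lin4Additive (abs_vsym_le summable_slices_decays_bdd bdd_comp_decays_bdd vsym_add lin4_bdd)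
open Summit.QuantumFields.BalabanUV.Beta.ChartConjugationReflection (trK_vertexOfK)
open Summit.QuantumFields.BalabanUV.Beta.HessKerDressedUnits (unitK decays_unitK)
open Summit.QuantumFields.BalabanUV.Beta.GAN24.CombesThomas (sfStep smStep)
open Summit.QuantumFields.BalabanUV.Beta.AxialDressingRooted (coDressKBmAt one_le_of_neZero decays_coDressKBmAt_KInvStep)
open Summit.QuantumFields.BalabanUV.Beta.GAN24.Lin4SlotDivergence (hH_unitK_comb)
open Summit.QuantumFields.BalabanUV.Beta.GAN24.Lin4LegDivergence (legDiv_lin4_left hM_unitK_comb hH_trK_unitK_comb hM_trK_unitK_comb)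
open Summit.QuantumFields.BalabanUV.Beta.TameKernelCalculus (trK trK_apply)
open Summit.QuantumFields.BalabanUV.Beta.GAN24.WardResidualSUnroll (sum_box_mul)
open Summit.QuantumFields.BalabanUV.Beta.GAN24.TransversalZeroMode (card_box_succ)
open Summit.QuantumFields.BalabanUV.Beta.GAN24.Lin4LegTower
open StepJetData (comp_add_right)

namespace Summit.QuantumFields.BalabanUV.Beta.GAN24.Lin4LegTowerTwo

variable {d : ℕ}

/-! ## §1 The bounded class: block sums, nested block sums, the one-step leg map -/

/-- [folklore] `bsum` of a bounded kernel is bounded (constant `N^{d+1}·B`). -/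
theorem bdd_bsum (N : ℕ) {F : MKer (d + 1) (Fib d)} {B : ℝ} (hF : Bdd F B) : Bdd (bsum N F) (((N : ℝ) ^ (d + 1)) * B) := by
  intro x y a b
  rw [bsum_apply]
  calc |∑ v ∈ box (d + 1) N, F x ((N : ℤ) • y + toSite v) a b|
      ≤ ∑ v ∈ box (d + 1) N, |F x ((N : ℤ) • y + toSite v) a b| := Finset.abs_sum_le_sum_abs _ _
    _ ≤ ∑ _v ∈ box (d + 1) N, B := Finset.sum_le_sum fun v _ => hF _ _ _ _
    _ = ((N : ℝ) ^ (d + 1)) * B := by rw [Finset.sum_const, card_box_succ, nsmul_eq_mul]; push_cast; ring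

/-- [folklore] **NESTED BLOCK SUMS OF THE POSITION INDEX**: `bsum (M·L) F = bsum L (bsum M F)` (`M ≥ 1`; p2's `sum_box_mul`) — `𝔹_N 𝔹_N = 𝔹_{N·N}`,
the super-block sum behind the m-fold form. -/
theorem bsum_mul {M : ℕ} (hM : 1 ≤ M) (L : ℕ) (F : MKer (d + 1) (Fib d)) : bsum (M * L) F = bsum L (bsum M F) := by
  funext x Y a b
  rw [bsum_apply, bsum_apply, sum_box_mul hM L (fun z => F x z a b) Y]
  exact Finset.sum_congr rfl fun c _ => (bsum_apply M F x _ a b).symm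

variable {N : ℕ} {G K : MKer (d + 1) (Fib d)} {CG δG CK δK : ℝ}
  {W W' : Fin (d + 1) → (Fin (d + 1) → ℤ) → Fin (d + 1) → (Fin (d + 1) → ℤ) → MKer (d + 1) (Fib d)} {B B' : ℝ}

/-- [folklore] **THE ONE-STEP LEG MAP PRESERVES THE BOUNDED CLASS** (constant displayed: `|kc| · |F| · C_K · Zl(δ_K) ·` leaf-01's `abs_vsym_le` constant). -/
theorem bdd_legStep (hG : Decays G CG δG) (hδG : 0 < δG) (hK : Decays K CK δK) (hδK : 0 < δK) (kc : ℝ)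
    (hW : ∀ κ u κ' u' x z a b, |W κ u κ' u' x z a b| ≤ B)
    (κ : Fin (d + 1)) (u : Site (d + 1)) (κ' : Fin (d + 1)) (u' : Site (d + 1)) (x z : Site (d + 1)) (a b : Fib d) :
    |legStep kc G K N W κ u κ' u' x z a b| ≤ |kc| * ((Fintype.card (Fib d) : ℝ) * (CK * Zl (d + 1) δK *
      (((d + 1 : ℕ) : ℝ) * (CG * Zl (d + 1) δG * (((d + 1 : ℕ) : ℝ) * (CG * Zl (d + 1) δG * B)))))) := by
  have hV : Bdd (vsym G N W κ u κ' u') _ := fun x z a b => abs_vsym_le hG hδG N hW κ u κ' u' x z a b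
  have hKV := bdd_comp_decays_bdd hK hδK hV
  have h0 : 0 ≤ (Fintype.card (Fib d) : ℝ) * (CK * Zl (d + 1) δK *
      (((d + 1 : ℕ) : ℝ) * (CG * Zl (d + 1) δG * (((d + 1 : ℕ) : ℝ) * (CG * Zl (d + 1) δG * B))))) :=
    (abs_nonneg _).trans (hKV 0 0 (Sum.inl 0) (Sum.inl 0))
  rcases a with α | ρ
  · rw [legStep_inl, abs_mul]
    exact mul_le_mul_of_nonneg_left (hKV _ _ _ _) (abs_nonneg _)
  · rw [legStep_inr, abs_zero]
    positivity

/-- [folklore] Additivity of the one-step leg map with two different table bounds. -/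
theorem legStep_add' (hG : Decays G CG δG) (hδG : 0 < δG) (hK : Decays K CK δK) (hδK : 0 < δK) (kc : ℝ)
    (hW : ∀ κ u κ' u' x z a b, |W κ u κ' u' x z a b| ≤ B) (hW' : ∀ κ u κ' u' x z a b, |W' κ u κ' u' x z a b| ≤ B')
    (κ : Fin (d + 1)) (u : Site (d + 1)) (κ' : Fin (d + 1)) (u' : Site (d + 1)) :
    legStep kc G K N (W + W') κ u κ' u' = legStep kc G K N W κ u κ' u' + legStep kc G K N W' κ u κ' u' :=
  legStep_add hG hδG hK hδK kc (B := max B B') (fun κ u κ' u' x z a b => (hW κ u κ' u' x z a b).trans (le_max_left _ _))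
    (fun κ u κ' u' x z a b => (hW' κ u κ' u' x z a b).trans (le_max_right _ _)) κ u κ' u'

/-! ## §2 The two-step form (k₀ = 2) -/

section Two

variable {K₀ K₁ : MKer (d + 1) (Fib d)} {C₀ δ₀ C₁ δ₁ cH₀ cH₁ : ℝ}
  {T F₀ F₁ : Fin (d + 1) → (Fin (d + 1) → ℤ) → Fin (d + 1) → (Fin (d + 1) → ℤ) → MKer (d + 1) (Fib d)} {BT B₀ : ℝ}

/-- [folklore] **(REP-leg), THE TWO-STEP FORM** (WARD6 (9.3), window k₀ = 2): for two consecutive affine steps `T₁ = lin4 c₀ K₀ N T + F₀`,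
`T₂ = lin4 c₁ K₁ N T₁ + F₁` with decaying `K₀, K₁` obeying (hH)∕(hM♯) (constants `c_{H,0}, c_{H,1}`), bounded `T, F₀`, the right-divergenced member two levels up is
`𝓛₁ (𝓛₀ (𝔹𝔹Δ)) + 𝓛₁ (𝔹 D^R F₀) + D^R F₁` — the chain `𝓛₁ ∘ 𝓛₀` on the super-block-summed `Δ = rdiv ∘ T`, the sources pushed once or not at all; NO CROSS TERMS. -/
theorem rdiv_lin4_two (hK₀ : Decays K₀ C₀ δ₀) (hδ₀ : 0 < δ₀) (hK₁ : Decays K₁ C₁ δ₁) (hδ₁ : 0 < δ₁) (hN : 1 ≤ N) (c₀ c₁ : ℝ)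
    (hT : ∀ κ u κ' u' x z a b, |T κ u κ' u' x z a b| ≤ BT) (hF₀ : ∀ κ u κ' u' x z a b, |F₀ κ u κ' u' x z a b| ≤ B₀)
    (hH₀ : ∀ (y : Site (d + 1)) (κ : Fin (d + 1)) (u : Site (d + 1)),
      ∑ μ, (colH K₀ N μ (y - unitVec μ) κ u - colH K₀ N μ y κ u) = cH₀ * gaugeWt N y κ u)
    (hMf₀ : ∀ (y x₂ : Site (d + 1)) (ρ : Fin (d + 1)),
      ∑ μ, (K₀ x₂ ((N : ℤ) • (y - unitVec μ)) (Sum.inr ρ) (Sum.inr μ) - K₀ x₂ ((N : ℤ) • y) (Sum.inr ρ) (Sum.inr μ)) = 0)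
    (hH₁ : ∀ (y : Site (d + 1)) (κ : Fin (d + 1)) (u : Site (d + 1)),
      ∑ μ, (colH K₁ N μ (y - unitVec μ) κ u - colH K₁ N μ y κ u) = cH₁ * gaugeWt N y κ u)
    (hMf₁ : ∀ (y x₂ : Site (d + 1)) (ρ : Fin (d + 1)),
      ∑ μ, (K₁ x₂ ((N : ℤ) • (y - unitVec μ)) (Sum.inr ρ) (Sum.inr μ) - K₁ x₂ ((N : ℤ) • y) (Sum.inr ρ) (Sum.inr μ)) = 0)
    (κ : Fin (d + 1)) (u : Site (d + 1)) (κ' : Fin (d + 1)) (u' : Site (d + 1)) :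
    rdiv ((lin4 c₁ K₁ N (lin4 c₀ K₀ N T + F₀) + F₁) κ u κ' u')
      = legStep (-(c₁ * cH₁)) K₁ K₁ N
            (legStep (-(c₀ * cH₀)) K₀ K₀ N (fun κ u κ' u' => bsum N (bsum N (rdiv (T κ u κ' u'))))) κ u κ' u'
        + legStep (-(c₁ * cH₁)) K₁ K₁ N (fun κ u κ' u' => bsum N (rdiv (F₀ κ u κ' u'))) κ u κ' u'
        + rdiv (F₁ κ u κ' u') := by
  -- the intermediate member is bounded (leaf-01's `lin4_bdd` + the source bound)
  obtain ⟨B₁, hB₁⟩ := lin4_bdd hK₀ hδ₀ c₀ N (T := T) ⟨BT, hT⟩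
  have hT₁ : ∀ κ u κ' u' x z a b, |(lin4 c₀ K₀ N T + F₀) κ u κ' u' x z a b| ≤ B₁ + B₀ := fun κ u κ' u' x z a b => by
    show |lin4 c₀ K₀ N T κ u κ' u' x z a b + F₀ κ u κ' u' x z a b| ≤ B₁ + B₀
    exact (abs_add_le _ _).trans (add_le_add (hB₁ κ u κ' u' x z a b) (hF₀ κ u κ' u' x z a b))
  -- level 1 → 2
  rw [rdiv_lin4_affine hK₁ hδ₁ hN c₁ hT₁ hH₁ hMf₁ F₁ κ u κ' u']
  -- level 0 → 1 inside the block sum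
  have hin : (fun κ u κ' u' => bsum N (rdiv ((lin4 c₀ K₀ N T + F₀) κ u κ' u')))
      = legStep (-(c₀ * cH₀)) K₀ K₀ N (fun κ u κ' u' => bsum N (bsum N (rdiv (T κ u κ' u'))))
        + fun κ u κ' u' => bsum N (rdiv (F₀ κ u κ' u')) := by
    funext κ₁ u₁ κ₁' u₁'
    rw [rdiv_lin4_affine hK₀ hδ₀ hN c₀ hT hH₀ hMf₀ F₀ κ₁ u₁ κ₁' u₁', bsum_add,
      bsum_legStep hK₀ hδ₀ hK₀ hδ₀ (-(c₀ * cH₀)) N (W := fun κ u κ' u' => bsum N (rdiv (T κ u κ' u')))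
        (fun κ u κ' u' x z a b => bdd_bsum N (bdd_rdiv (fun x z a b => hT κ u κ' u' x z a b)) x z a b) κ₁ u₁ κ₁' u₁']
    rfl
  rw [hin, legStep_add' hK₁ hδ₁ hK₁ hδ₁ (-(c₁ * cH₁))
    (fun κ u κ' u' x z a b => bdd_legStep hK₀ hδ₀ hK₀ hδ₀ (-(c₀ * cH₀)) (N := N)
      (fun κ u κ' u' x z a b => bdd_bsum N (bdd_bsum N (bdd_rdiv (fun x z a b => hT κ u κ' u' x z a b))) x z a b) κ u κ' u' x z a b)
    (fun κ u κ' u' x z a b => bdd_bsum N (bdd_rdiv (fun x z a b => hF₀ κ u κ' u' x z a b)) x z a b)]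

/-- [folklore] The super-block display of the two-step member: `bsum N (bsum N Δ) = bsum (N·N) Δ` (`N ≥ 1`). -/
theorem bsum_bsum_eq (hN : 1 ≤ N) (F : MKer (d + 1) (Fib d)) : bsum N (bsum N F) = bsum (N * N) F :=
  (bsum_mul hN N F).symm

end Two

/-! ## §3 The left-leg mirror through the transpose -/

/-- [folklore] Plumbing `def`: **THE BACKWARD DIVERGENCE OF THE LEFT FIELD LEG**, the former left site kept as a position index `p` (in the `x`-slot),
constant in the dummy left fibre index: `ldiv F := trK (rdiv (trK F))`. -/
def ldiv (F : MKer (d + 1) (Fib d)) : MKer (d + 1) (Fib d) := trK (rdiv (trK F))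

/-- [folklore] The entries of `ldiv`: `Σ_α (F (p − e_α) z (inl α) b − F p z (inl α) b)`. -/
theorem ldiv_apply (F : MKer (d + 1) (Fib d)) (p z : Site (d + 1)) (a b : Fib d) :
    ldiv F p z a b = ∑ α, (F (p - unitVec α) z (Sum.inl α) b - F p z (Sum.inl α) b) := by
  simp only [ldiv, trK_apply, rdiv_apply]

/-- [folklore] **THE TRANSPOSE OF `vsym` IS `vsym` OF THE TRANSPOSED TABLE, SAME SLOT KERNEL** (`trK_vertexOfK` twice; the ℋ-columns of `K` are untouched). -/
theorem trK_vsym (K : MKer (d + 1) (Fib d)) (N : ℕ)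
    (T : Fin (d + 1) → (Fin (d + 1) → ℤ) → Fin (d + 1) → (Fin (d + 1) → ℤ) → MKer (d + 1) (Fib d))
    (μ : Fin (d + 1)) (y : Site (d + 1)) (ν : Fin (d + 1)) (y' : Site (d + 1)) :
    trK (vsym K N T μ y ν y') = vsym K N (fun κ u κ' u' => trK (T κ u κ' u')) μ y ν y' := by
  funext x z a b
  rfl

section Left

variable {K : MKer (d + 1) (Fib d)} {C δ : ℝ}
  {T : Fin (d + 1) → (Fin (d + 1) → ℤ) → Fin (d + 1) → (Fin (d + 1) → ℤ) → MKer (d + 1) (Fib d)} {B : ℝ} {cH' : ℝ}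

/-- [folklore] **(REP-leg), LEFT LEG — THE CLOSED ONE-STEP IDENTITY THROUGH THE TRANSPOSE**: for a decaying `K` whose transpose obeys (hH′) (constant `c_H′`)
and (hM♯′), `N ≥ 1`, bounded `T`, any `c`, every slot quadruple `s`:
`ldiv (lin4 c K N T s) = trK (legStep (−(c·c_H′)) K (trK K) N (fun s ↦ bsum N (rdiv (trK (T s)))) s)` — slots through `vsym` with `K`'s ℋ-columns, the leg
through one row of `trK K` (gen-58's `legDiv_lin4_left` + part 1 §2–§3 on the transposed data). -/
theorem ldiv_lin4 (hK : Decays K C δ) (hδ : 0 < δ) (hN : 1 ≤ N) (c : ℝ) (hT : ∀ κ u κ' u' x z a b, |T κ u κ' u' x z a b| ≤ B)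
    (hH' : ∀ (y : Site (d + 1)) (κ : Fin (d + 1)) (u : Site (d + 1)),
      ∑ μ, (colH (trK K) N μ (y - unitVec μ) κ u - colH (trK K) N μ y κ u) = cH' * gaugeWt N y κ u)
    (hMf' : ∀ (y x₂ : Site (d + 1)) (ρ : Fin (d + 1)),
      ∑ μ, (trK K x₂ ((N : ℤ) • (y - unitVec μ)) (Sum.inr ρ) (Sum.inr μ) - trK K x₂ ((N : ℤ) • y) (Sum.inr ρ) (Sum.inr μ)) = 0)
    (κ : Fin (d + 1)) (u : Site (d + 1)) (κ' : Fin (d + 1)) (u' : Site (d + 1)) :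
    ldiv (lin4 c K N T κ u κ' u')
      = trK (legStep (-(c * cH')) K (trK K) N (fun κ u κ' u' => bsum N (rdiv (trK (T κ u κ' u')))) κ u κ' u') := by
  -- transposed data: `trK K` decays at the same rate; `trK ∘ T` and `trK (vsym …)` are bounded by the same constants
  have hKt : Decays (trK K) C δ := fun x z a b => by
    rw [trK_apply, ExpKernelCalculus.l1_sub_symm]; exact hK z x b a
  have hTt : ∀ κ u κ' u' x z a b, |trK (T κ u κ' u') x z a b| ≤ B := fun κ u κ' u' x z a b => by
    rw [trK_apply]; exact hT κ u κ' u' z x b a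
  have hVt : Bdd (trK (vsym K N T κ u κ' u')) _ := fun x z a b => by
    rw [trK_apply]; exact abs_vsym_le hK hδ N hT κ u κ' u' z x b a
  funext p z' a b
  rcases b with β | ν
  · rw [ldiv_apply, trK_apply, legStep_inl, legDiv_lin4_left hK hδ hN c hT hH' hMf' κ u κ' u' z' β p,
      vsym_bsum_rdiv hK hδ N N (T := fun κ u κ' u' => trK (T κ u κ' u')) hTt κ u κ' u', ← trK_vsym,
      comp_bsum N (summable_slices_decays_bdd hKt hδ (bdd_rdiv hVt)), comp_rdiv (summable_slices_decays_bdd hKt hδ hVt)]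
    simp only [bsum_apply, rdiv_apply]
  · rw [ldiv_apply, trK_apply, legStep_inr]
    refine Finset.sum_eq_zero fun α _ => ?_
    rw [lin4_apply]
    simp only [Pi.neg_apply, Pi.smul_apply, mmRead_inr_right, smul_zero, neg_zero, sub_self]

end Left

/-! ## §4 The comb ∕ wall instances -/

section Comb

variable {Lc : ℕ} [NeZero Lc] {r : Fin (d + 1) → ℕ}

/-- [folklore] **(REP-leg), LEFT LEG, FOR THE DRESSED COMB STEP** (every `j`, every in-block root; `c_H′ = −(Lc^{d+1})⁻¹` by `BubbleParity.trK_coDressKBmAt_KInvStep`,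
so the coupling is `−(c · (−(Lc^{d+1})⁻¹))`): `ldiv (lin4 c K♮ᴱ_j Lc T s) = trK (legStep (−(c·(−(Lc^{d+1})⁻¹))) K♮ᴱ_j (trK K♮ᴱ_j) Lc (fun s ↦ bsum Lc (rdiv (trK (T s)))) s)`. -/
theorem ldiv_lin4_comb (hr : r ∈ box (d + 1) Lc) (j : ℕ) (c : ℝ)
    {T : Fin (d + 1) → (Fin (d + 1) → ℤ) → Fin (d + 1) → (Fin (d + 1) → ℤ) → MKer (d + 1) (Fib d)} {B : ℝ}
    (hT : ∀ κ u κ' u' x z a b, |T κ u κ' u' x z a b| ≤ B)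
    (κ : Fin (d + 1)) (u : Site (d + 1)) (κ' : Fin (d + 1)) (u' : Site (d + 1)) :
    ldiv (lin4 c (unitK (sfStep Lc j) (smStep d Lc j) (coDressKBmAt (toSite r) Lc (KInvStep (d := d) Lc j))) Lc T κ u κ' u')
      = trK (legStep (-(c * -((Lc : ℝ) ^ (d + 1))⁻¹))
          (unitK (sfStep Lc j) (smStep d Lc j) (coDressKBmAt (toSite r) Lc (KInvStep (d := d) Lc j)))
          (trK (unitK (sfStep Lc j) (smStep d Lc j) (coDressKBmAt (toSite r) Lc (KInvStep (d := d) Lc j)))) Lc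
          (fun κ u κ' u' => bsum Lc (rdiv (trK (T κ u κ' u')))) κ u κ' u') := by
  obtain ⟨δK, CK, hδK, -, hG⟩ := decays_coDressKBmAt_KInvStep (d := d) hr j
  exact ldiv_lin4 (decays_unitK hG) hδK (one_le_of_neZero Lc) c hT (hH_trK_unitK_comb hr j) (hM_trK_unitK_comb hr j) κ u κ' u'

/-- [folklore] **THE TWO-STEP FORM FOR THE DRESSED COMB STEPS** `K♮ᴱ_j`, `K♮ᴱ_{j+1}` (in-block roots `r`, `r′`; `N = Lc` at both levels; couplings `c₀`, `c₁`):
`rdiv ((lin4 c₁ K♮ᴱ_{j+1} Lc (lin4 c₀ K♮ᴱ_j Lc T + F₀) + F₁) s) = 𝓛_{j+1}(𝓛_j(𝔹𝔹Δ)) s + 𝓛_{j+1}(𝔹 (rdiv ∘ F₀)) s + rdiv (F₁ s)`. -/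
theorem rdiv_lin4_two_comb {r' : Fin (d + 1) → ℕ} (hr : r ∈ box (d + 1) Lc) (hr' : r' ∈ box (d + 1) Lc) (j : ℕ) (c₀ c₁ : ℝ)
    {T F₀ F₁ : Fin (d + 1) → (Fin (d + 1) → ℤ) → Fin (d + 1) → (Fin (d + 1) → ℤ) → MKer (d + 1) (Fib d)} {BT B₀ : ℝ}
    (hT : ∀ κ u κ' u' x z a b, |T κ u κ' u' x z a b| ≤ BT) (hF₀ : ∀ κ u κ' u' x z a b, |F₀ κ u κ' u' x z a b| ≤ B₀)
    (κ : Fin (d + 1)) (u : Site (d + 1)) (κ' : Fin (d + 1)) (u' : Site (d + 1)) :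
    rdiv ((lin4 c₁ (unitK (sfStep Lc (j + 1)) (smStep d Lc (j + 1)) (coDressKBmAt (toSite r') Lc (KInvStep (d := d) Lc (j + 1)))) Lc
        (lin4 c₀ (unitK (sfStep Lc j) (smStep d Lc j) (coDressKBmAt (toSite r) Lc (KInvStep (d := d) Lc j))) Lc T + F₀) + F₁) κ u κ' u')
      = legStep (-(c₁ * ((Lc : ℝ) ^ (d + 1))⁻¹))
            (unitK (sfStep Lc (j + 1)) (smStep d Lc (j + 1)) (coDressKBmAt (toSite r') Lc (KInvStep (d := d) Lc (j + 1))))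
            (unitK (sfStep Lc (j + 1)) (smStep d Lc (j + 1)) (coDressKBmAt (toSite r') Lc (KInvStep (d := d) Lc (j + 1)))) Lc
            (legStep (-(c₀ * ((Lc : ℝ) ^ (d + 1))⁻¹))
              (unitK (sfStep Lc j) (smStep d Lc j) (coDressKBmAt (toSite r) Lc (KInvStep (d := d) Lc j)))
              (unitK (sfStep Lc j) (smStep d Lc j) (coDressKBmAt (toSite r) Lc (KInvStep (d := d) Lc j))) Lc
              (fun κ u κ' u' => bsum Lc (bsum Lc (rdiv (T κ u κ' u'))))) κ u κ' u'
        + legStep (-(c₁ * ((Lc : ℝ) ^ (d + 1))⁻¹))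
            (unitK (sfStep Lc (j + 1)) (smStep d Lc (j + 1)) (coDressKBmAt (toSite r') Lc (KInvStep (d := d) Lc (j + 1))))
            (unitK (sfStep Lc (j + 1)) (smStep d Lc (j + 1)) (coDressKBmAt (toSite r') Lc (KInvStep (d := d) Lc (j + 1)))) Lc
            (fun κ u κ' u' => bsum Lc (rdiv (F₀ κ u κ' u'))) κ u κ' u'
        + rdiv (F₁ κ u κ' u') := by
  obtain ⟨δ₀, C₀, hδ₀, -, hG₀⟩ := decays_coDressKBmAt_KInvStep (d := d) hr j
  obtain ⟨δ₁, C₁, hδ₁, -, hG₁⟩ := decays_coDressKBmAt_KInvStep (d := d) hr' (j + 1)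
  exact rdiv_lin4_two (decays_unitK hG₀) hδ₀ (decays_unitK hG₁) hδ₁ (one_le_of_neZero Lc) c₀ c₁ hT hF₀
    (hH_unitK_comb hr j) (hM_unitK_comb j) (hH_unitK_comb hr' (j + 1)) (hM_unitK_comb (j + 1)) κ u κ' u'

end Comb

end Summit.QuantumFields.BalabanUV.Beta.GAN24.Lin4LegTowerTwo
end
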